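import Summits.Ventures.PercRepro.ClassSum

/-!
# PercRepro — `(5a)_class`: the class-level pendant Lemma 5a as a `Prop` (typer-2, gen 5; p1 §T)

p1 (`proofs/P1-census-g3.md` §O–§P, §T; INBOX 09:22:32Z; ASSIGNMENTS v32 typer-2 (c)): the statement the
3|1-bridge case of the (M)-induction / Lemma B⁺ needs is the PENDANT restriction of the class-level
principle on the FULL cube. For a marked multigraph with a PENDANT MARK `a` — `g` is an edge at `a` and the
only edge at `a` — the class sum `S(⊤, ⊥)` of the Lemma-5 kernel along `g` (`classSum`, `ClassSum.lean`:
`−Σ_ρ Q⁺(m(ρ), m(ρᶜ))` over the ordered antipodal pairs of the cube of ALL edges) is nonnegative.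

* **`PendantClassSumNonneg`** — `(5a)_class`, verbatim p1 §T (quantifying over all `G` covers every minor
  with a pendant mark, so the full cube suffices);
* `pendantClassSumNonneg_of_classSumNonneg` — it is the pendant case of the (FALSE, gadget) class-level
  principle `ClassSumNonneg`: the pendant case has no gadget (p1 §P).

Facts of record (p1): `(5a)_class` = (H) = «T ≥ CS⁺» = contraction monotonicity of the Lemma-B⁺ class sum at a
pendant marked edge (exact on 9,720 + 72,520 instances); census-true on every `G` with ≤ 7 vertices and on
the n = 8, m ≤ 11 pendant extensions; gen-2 Block-I census 0 / 16,279,200 classes. Its PRODUCT-level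
companion is a theorem: `PendantFiveA` (`Lemma6.lean`) via `Lemma6Pendant_holds`. The §R rule
(`cb+hybrid`) is the candidate injection: collision-free on all graphs with ≤ 6 vertices.
-/

namespace PercRepro

/-- **`(5a)_class` — the class-level pendant Lemma 5a** (p1 §T): if the mark `a` is PENDANT — `g` is an
edge at `a` and every edge at `a` is `g` — then the class sum of the Lemma-5 kernel along `g` on the full
cube (join `⊤ = fun _ => true`, meet `⊥ = fun _ => false`, every edge free) is nonnegative. -/
def PendantClassSumNonneg : Prop :=
  ∀ {V E : Type} [Fintype E] [DecidableEq E] (G : MultiGraph V E) (g : E) (a b c d : V),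
    [a, b, c, d].Nodup → (G.fst g = a ∨ G.snd g = a) → (∀ e, (G.fst e = a ∨ G.snd e = a) → e = g) →
      0 ≤ G.classSum g ![a, b, c, d] (fun _ => true) (fun _ => false)

/-- The (false) class-level principle `ClassSumNonneg` restricts to `(5a)_class`. -/
theorem pendantClassSumNonneg_of_classSumNonneg (h : ClassSumNonneg) : PendantClassSumNonneg :=
  fun G g a b c d _ _ _ => h G g a b c d _ _ fun _ => Bool.false_le _

end PercRepro
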